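/-
Copyright (c) 2026 the pub-hodgecm-mathlib formalisation cell (harness21).  Prover seat hodgecm-mathlib-LH4-p13 (g10), req620 Track A «(D-RAM) FOUR-FRAME» squad
F0∕P3c∕LH4; the (β₂) road (R-36), β₂ WORD #22 (2) of the sub-dealer LH4-p04 (g9) «THE LABEL LAW», dealt by first refusal to this seat — FILE 1 of 2, the frame-free
ENGINE; helper lane on h413 = stmt-HodgeConjecture-24833 (count-neutral).  2026-09-05.
-/
import Literature.NumberTheory.Automorphic.UnitaryLatticeTreeTypes     -- ★ (brings Mathlib's `Matrix.adjugate`, `Valued`, `ℤᵐ⁰`; nothing of it is used by name here)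
import HarnessLib

/-!
# Crux `H413`, line LH4 «(D-RAM) FOUR-FRAME» — the (β₂) road (R-36), β₂ WORD #22 (2) «THE LABEL LAW», FILE 1 of 2: «A NEARLY RANK-ONE, NEARLY SKEW GRAM OPERATOR HAS THE
# VALUE SET OF ONE RAY» — the `K`-wide engine (no datum, no lattice, no form: a `3 × 3` matrix `Q` over a valued field)

Cell `hodgecm-mathlib` (D-0151), FLOOR 0, crux item H413 = `stmt-HodgeConjecture-24833`, route of record `HCCMUnconditional`; squad F0∕P3c∕LH4; lane
`--supports stmt-HodgeConjecture-24833 --as helper` (count-neutral; pays NO tier-0 row).  THEOREMS ONLY (no `def`, no instance, no notation, no `sorry`, default heartbeats);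
states NO census law.  Consumed by FILE 2 `Theorems/F0P3cDyRamCleanShellLabelLaw.lean` (the label law at a self-dual vertex of any hermitian form, and its two ‹OFF.v2› literals).

THE MECHANISM (new; answers (OFF) lead LH7-p09 (g2) BETA2-OFF-RESIDUAL v1 §2 «HOW the cross terms of the MIX band keep one class»).  For the Gram operator `Q = (σg)ᵀ·H·X·g`
of `X = Γ − 1` at a self-dual vertex `L = g·𝒪³` (FILE 2), the clean shell and the fence make ALL `2 × 2` MINORS of `Q` vanish mod `ϖ^{m_c}` (§1: `adj X = X² − (tr X)·X + e₂(X)·1`,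
`adj(g⁻¹Xg) = g⁻¹(adj X)g`, `adj(GB) = adj B · adj G`), and unitarity makes `Q` SKEW mod `ϖ^{m_c}` (§1: `Q + (σQ)ᵀ = (σg)ᵀ·H·Γ⁻¹X²·g`).  §3 is the pure valuation algebra that turns
«rank one + skew, one entry of exact level `ℓ`» into «the `ϖ^m`-thickened value set of `c ↦ (σc)ᵀQc` on `𝒪³` is the thickened ray `{e₀·N(a) : |a| ≤ 1}`» for every `m ≤ P`:
(i) skewness and a principal minor put an entry of exact level `ℓ` ON THE DIAGONAL, `Q_pp`; (ii) with `λ(y) = Σᵢ σ(yᵢ)Q_ip`, `ρ(y) = Σⱼ Q_pj yⱼ` the pivot minors give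
`Q_pp·(σy)ᵀQy ≡ λ(y)·ρ(y)` and skewness at `(y, e_p)` gives `ρ(y) ≡ −σλ(y)` (mod `ϖ^{ℓ+P}`), so `(σy)ᵀQy ≡ e₀·N(λ(y)∕Q_pp)` (mod `ϖ^P`) with `e₀ = −σQ_pp`; (iii) `y = σa·e_p`
realises every `a`.  So the cross terms NEVER carry an independent second slot: the skew relation ties the row functional to the column functional.
* §1 `adjugate_eq_sq_sub_trace_smul_add`, `adjugate_coe_units_eq_det_smul_inv`, `adjugate_units_conj`, `map_transpose_mul_eq_mul_inv_of_unitary`, `gram_add_map_transpose_eq`.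
* §2 `v_mul_apply_le`, `v_le_pow_succ_of_v_lt_pow` (discreteness), `v_pivotMinor_le_of_adjugate` (the 27 pivot minors are `0` or `±` adjugate entries).
* §3 HEAD **`exists_rayScalar_setOf_eq_of_pivotMinors`**.

HONEST LABEL.  Count-neutral matrix ∕ valuation algebra; nothing printed is asserted; no census law is stated; (β₂), ‹OFF.v2›'s residue and ‹CORE-REST› stay OPEN with their
holders; `HC_CM` is proved only modulo the 7 printed citations (2 remaining named inputs: hLiu418 = `stmt-HodgeConjecture-24832`, h413 = `stmt-HodgeConjecture-24833`) until rung 0 closes.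

## References
* [Rogawski1990] J. D. Rogawski, *Automorphic Representations of Unitary Groups in Three Variables*, Ann. of Math. Stud. 123 (1990): §1.10 p. 9 (`X + X* = −X*X`), §4.9
  Prop. 4.9.1 (b) p. 55 (the two transvection classes read through hermitian values).
* [Kottwitz1986BaseChangeUnits] R. E. Kottwitz, *Base change for unit elements of Hecke algebras*, Compositio Math. 60 (1986): §1 pp. 240–241, §3.
* [Jacobowitz1962] R. Jacobowitz, *Hermitian forms over local fields*, Amer. J. Math. 84 (1962): §4 (hermitian Gram matrices).
* [Serre1979] J.-P. Serre, *Local Fields*, GTM 67 (1979): Ch. II §1 (discrete valuations).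
* [Serre1980Trees] J.-P. Serre, *Trees* (1980): Ch. II §1.1 (`GL_n` acting on lattices; `adj g = det g · g⁻¹`).
-/

set_option autoImplicit false

noncomputable section

namespace Summit.HodgeConjecture.HodgeConjecture.Cruxes.H413.F0P3cDyRamRankOneSkewValueSet

open scoped Valued WithZero Matrix MatrixGroups
open WithZero

/-! ## §1  Matrix algebra: the `3 × 3` adjugate as a polynomial in `X`, the adjugate of a conjugate, the skew identity of a unitary `Γ` -/

section MatrixAlgebra

variable {R : Type*} [CommRing R]

/-- **`adj X = X² − (tr X)·X + e₂(X)·1` FOR `3 × 3` MATRICES** (Cayley–Hamilton; `e₂` = the sum of the principal `2 × 2` minors). [cite: Kottwitz1986BaseChangeUnits, §3] -/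
theorem adjugate_eq_sq_sub_trace_smul_add (X : Matrix (Fin 3) (Fin 3) R) :
    X.adjugate = X * X - X.trace • X +
      (X 0 0 * X 1 1 + X 0 0 * X 2 2 + X 1 1 * X 2 2 - X 0 1 * X 1 0 - X 0 2 * X 2 0 - X 1 2 * X 2 1) •
        (1 : Matrix (Fin 3) (Fin 3) R) := by
  ext i j
  rw [Matrix.adjugate_fin_three, Matrix.trace_fin_three]
  fin_cases i <;> fin_cases j <;> simp [Matrix.mul_apply, Fin.sum_univ_three] <;> ring

/-- `adj g = det g · g⁻¹` for `g ∈ GL_n`. [cite: Serre1980Trees, Ch. II §1.1] -/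
theorem adjugate_coe_units_eq_det_smul_inv {n : Type*} [Fintype n] [DecidableEq n] (g : GL n R) :
    (g : Matrix n n R).adjugate = (g : Matrix n n R).det • ((g⁻¹ : GL n R) : Matrix n n R) := by
  calc (g : Matrix n n R).adjugate
      = ((g⁻¹ : GL n R) : Matrix n n R) * ((g : Matrix n n R) * (g : Matrix n n R).adjugate) := by
          rw [← Matrix.mul_assoc, ← Units.val_mul, inv_mul_cancel, Units.val_one, Matrix.one_mul]
    _ = (g : Matrix n n R).det • ((g⁻¹ : GL n R) : Matrix n n R) := by
          rw [Matrix.mul_adjugate, Matrix.mul_smul, Matrix.mul_one]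

/-- **THE ADJUGATE OF A CONJUGATE**: `adj(g⁻¹Xg) = g⁻¹·(adj X)·g`. [cite: Serre1980Trees, Ch. II §1.1] -/
theorem adjugate_units_conj {n : Type*} [Fintype n] [DecidableEq n] (g : GL n R) (X : Matrix n n R) :
    (((g⁻¹ : GL n R) : Matrix n n R) * X * (g : Matrix n n R)).adjugate =
      ((g⁻¹ : GL n R) : Matrix n n R) * X.adjugate * (g : Matrix n n R) := by
  have hdet : (g : Matrix n n R).det * ((g⁻¹ : GL n R) : Matrix n n R).det = 1 := by
    rw [← Matrix.det_mul, ← Units.val_mul, mul_inv_cancel, Units.val_one, Matrix.det_one]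
  rw [Matrix.adjugate_mul_distrib, Matrix.adjugate_mul_distrib, adjugate_coe_units_eq_det_smul_inv g,
    adjugate_coe_units_eq_det_smul_inv g⁻¹, inv_inv, Matrix.smul_mul, Matrix.mul_smul, Matrix.mul_smul, smul_smul, hdet, one_smul,
    Matrix.mul_assoc]

/-- `(σγ)ᵀH = H·γ⁻¹` for `Γ ∈ U(σ, H)`. [cite: Rogawski1990, §1.10 p. 9] -/
theorem map_transpose_mul_eq_mul_inv_of_unitary {σ : R →+* R} {H γ γi : Matrix (Fin 3) (Fin 3) R}
    (hγ : (γ.map σ)ᵀ * H * γ = H) (hγi : γ * γi = 1) : (γ.map σ)ᵀ * H = H * γi := by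
  calc (γ.map σ)ᵀ * H = (γ.map σ)ᵀ * H * (γ * γi) := by rw [hγi, Matrix.mul_one]
    _ = H * γi := by rw [← Matrix.mul_assoc, hγ]

/-- **THE SKEW IDENTITY OF A UNITARY OPERATOR, IN A BASIS**: `σ` an involution, `(σH)ᵀ = H`, `(σγ)ᵀHγ = H`, `γγ⁻¹ = 1`, `X = γ − 1`, `Q = (σg)ᵀ·H·X·g` ⟹
`Q + (σQ)ᵀ = (σg)ᵀ·H·(γ⁻¹·X²)·g` (`HX + XᴴH = −XᴴHX = HΓ⁻¹X²`). [cite: Rogawski1990, §1.10 p. 9] [cite: Jacobowitz1962, §4] -/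
theorem gram_add_map_transpose_eq {σ : R →+* R} (hσ : ∀ a, σ (σ a) = a) {H γ γi : Matrix (Fin 3) (Fin 3) R}
    (hH : (H.map σ)ᵀ = H) (hγ : (γ.map σ)ᵀ * H * γ = H) (hγi : γ * γi = 1) (g : Matrix (Fin 3) (Fin 3) R) :
    (g.map σ)ᵀ * H * (γ - 1) * g + (((g.map σ)ᵀ * H * (γ - 1) * g).map σ)ᵀ =
      (g.map σ)ᵀ * H * (γi * ((γ - 1) * (γ - 1))) * g := by
  have hγi' : γi * γ = 1 := mul_eq_one_comm.1 hγi
  have h1 : (γ.map σ)ᵀ * H = H * γi := map_transpose_mul_eq_mul_inv_of_unitary hγ hγi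
  have hmm : ∀ M : Matrix (Fin 3) (Fin 3) R, (M.map σ).map σ = M := fun M => by
    ext i j; simp only [Matrix.map_apply, hσ]
  have hXσ : ((γ - 1).map σ)ᵀ = (γ.map σ)ᵀ - 1 := by
    rw [Matrix.map_sub σ (map_sub σ), Matrix.map_one σ (map_zero σ) (map_one σ), Matrix.transpose_sub, Matrix.transpose_one]
  -- the transposed conjugate of `Q`
  have h2 : (((g.map σ)ᵀ * H * (γ - 1) * g).map σ)ᵀ = (g.map σ)ᵀ * ((((γ.map σ)ᵀ - 1) * H) * g) := by
    rw [Matrix.map_mul, Matrix.map_mul, Matrix.map_mul, Matrix.transpose_map, hmm,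
      Matrix.transpose_mul, Matrix.transpose_mul, Matrix.transpose_mul, Matrix.transpose_transpose, hH, hXσ]
    simp only [Matrix.mul_assoc]
  -- `γ⁻¹·(γ − 1)² = (γ − 1) + (γ⁻¹ − 1)` and `H(γ − 1) + ((σγ)ᵀ − 1)H = H·γ⁻¹·(γ − 1)²`
  have e : γi * ((γ - 1) * (γ - 1)) = (γ - 1) + (γi - 1) := by
    simp only [Matrix.mul_sub, Matrix.sub_mul, Matrix.mul_one, Matrix.one_mul, ← Matrix.mul_assoc, hγi']
    abel
  have h3 : H * (γ - 1) + ((γ.map σ)ᵀ - 1) * H = H * (γi * ((γ - 1) * (γ - 1))) := by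
    rw [Matrix.sub_mul, Matrix.one_mul, h1, e]
    simp only [Matrix.mul_add, Matrix.mul_sub, Matrix.mul_one]
  rw [h2, show (g.map σ)ᵀ * H * (γi * ((γ - 1) * (γ - 1))) * g = (g.map σ)ᵀ * ((H * (γi * ((γ - 1) * (γ - 1)))) * g) by
    simp only [Matrix.mul_assoc], ← h3, Matrix.add_mul, Matrix.mul_add]
  simp only [Matrix.mul_assoc]

end MatrixAlgebra

/-! ## §2  Valuation bookkeeping for `3 × 3` matrices -/

section Valuations

variable {K : Type} [Field K] [Valued K ℤᵐ⁰]

/-- Entries of a product: `|A| ≤ a`, `|B| ≤ b ⟹ |A·B| ≤ a·b`. [cite: Serre1980Trees, Ch. II §1.1] -/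
theorem v_mul_apply_le {A B : Matrix (Fin 3) (Fin 3) K} {a b : ℤᵐ⁰} (hA : ∀ i j, Valued.v (A i j) ≤ a) (hB : ∀ i j, Valued.v (B i j) ≤ b)
    (i j : Fin 3) : Valued.v ((A * B) i j) ≤ a * b := by
  rw [Matrix.mul_apply]
  exact Valuation.map_sum_le _ fun k _ => by rw [map_mul]; exact mul_le_mul' (hA i k) (hB k j)

/-- **DISCRETENESS**: `|ϖ| = exp(−1)`, `|x| < |ϖ|ⁿ ⟹ |x| ≤ |ϖ|ⁿ⁺¹`. [cite: Serre1979, Ch. II §1] -/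
theorem v_le_pow_succ_of_v_lt_pow {ϖ : K} (hϖ : Valued.v ϖ = exp (-1 : ℤ)) {x : K} {n : ℕ} (h : Valued.v x < Valued.v ϖ ^ n) :
    Valued.v x ≤ Valued.v ϖ ^ (n + 1) := by
  rcases eq_or_ne x 0 with rfl | hx
  · rw [map_zero]; exact zero_le
  have hvx : Valued.v x ≠ 0 := (Valuation.ne_zero_iff _).2 hx
  rw [hϖ, ← exp_nsmul, ← exp_log hvx, exp_lt_exp] at h
  rw [hϖ, ← exp_nsmul, ← exp_log hvx, exp_le_exp]
  simp only [nsmul_eq_mul, mul_neg, mul_one, Nat.cast_add, Nat.cast_one] at h ⊢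
  omega

/-- **THE PIVOT MINORS ARE ADJUGATE ENTRIES**: if every entry of `adj Q` has `|·| ≤ c` then `|Q_pp·Q_ij − Q_ip·Q_pj| ≤ c` for all `p, i, j` (for `i = p` or `j = p` the minor is
`0`; otherwise it is `±` an entry of `adj Q`). [cite: Jacobowitz1962, §4] -/
theorem v_pivotMinor_le_of_adjugate {Q : Matrix (Fin 3) (Fin 3) K} {c : ℤᵐ⁰} (hadj : ∀ a b, Valued.v (Q.adjugate a b) ≤ c) (p i j : Fin 3) :
    Valued.v (Q p p * Q i j - Q i p * Q p j) ≤ c := by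
  have h0 : ∀ x : K, x = 0 → Valued.v x ≤ c := fun x hx => by rw [hx, map_zero]; exact zero_le
  have hn : ∀ x : K, Valued.v (-x) ≤ c → Valued.v x ≤ c := fun x hx => by rwa [Valuation.map_neg] at hx
  have e00 : Q.adjugate 0 0 = Q 1 1 * Q 2 2 - Q 1 2 * Q 2 1 := by rw [Matrix.adjugate_fin_three]; rfl
  have e01 : Q.adjugate 0 1 = -(Q 0 1 * Q 2 2) + Q 0 2 * Q 2 1 := by rw [Matrix.adjugate_fin_three]; rfl
  have e02 : Q.adjugate 0 2 = Q 0 1 * Q 1 2 - Q 0 2 * Q 1 1 := by rw [Matrix.adjugate_fin_three]; rfl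
  have e10 : Q.adjugate 1 0 = -(Q 1 0 * Q 2 2) + Q 1 2 * Q 2 0 := by rw [Matrix.adjugate_fin_three]; rfl
  have e11 : Q.adjugate 1 1 = Q 0 0 * Q 2 2 - Q 0 2 * Q 2 0 := by rw [Matrix.adjugate_fin_three]; rfl
  have e12 : Q.adjugate 1 2 = -(Q 0 0 * Q 1 2) + Q 0 2 * Q 1 0 := by rw [Matrix.adjugate_fin_three]; rfl
  have e20 : Q.adjugate 2 0 = Q 1 0 * Q 2 1 - Q 1 1 * Q 2 0 := by rw [Matrix.adjugate_fin_three]; rfl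
  have e21 : Q.adjugate 2 1 = -(Q 0 0 * Q 2 1) + Q 0 1 * Q 2 0 := by rw [Matrix.adjugate_fin_three]; rfl
  have e22 : Q.adjugate 2 2 = Q 0 0 * Q 1 1 - Q 0 1 * Q 1 0 := by rw [Matrix.adjugate_fin_three]; rfl
  fin_cases p <;> fin_cases i <;> fin_cases j
  all_goals simp only [Fin.zero_eta, Fin.mk_one, Fin.reduceFinMk, Fin.isValue]
  · apply h0; rw [sub_self]
  · apply h0; rw [sub_self]
  · apply h0; rw [sub_self]
  · apply h0; rw [mul_comm, sub_self]
  · convert hadj 2 2 using 2; rw [e22]; ring1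
  · apply hn; convert hadj 1 2 using 2; rw [e12]; ring1
  · apply h0; rw [mul_comm, sub_self]
  · apply hn; convert hadj 2 1 using 2; rw [e21]; ring1
  · convert hadj 1 1 using 2; rw [e11]; ring1
  · convert hadj 2 2 using 2; rw [e22]; ring1
  · apply h0; rw [mul_comm, sub_self]
  · apply hn; convert hadj 0 2 using 2; rw [e02]; ring1
  · apply h0; rw [sub_self]
  · apply h0; rw [sub_self]
  · apply h0; rw [sub_self]
  · apply hn; convert hadj 2 0 using 2; rw [e20]; ring1
  · apply h0; rw [mul_comm, sub_self]
  · convert hadj 0 0 using 2; rw [e00]; ring1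
  · convert hadj 1 1 using 2; rw [e11]; ring1
  · apply hn; convert hadj 0 1 using 2; rw [e01]; ring1
  · apply h0; rw [mul_comm, sub_self]
  · apply hn; convert hadj 1 0 using 2; rw [e10]; ring1
  · convert hadj 0 0 using 2; rw [e00]; ring1
  · apply h0; rw [mul_comm, sub_self]
  · apply h0; rw [sub_self]
  · apply h0; rw [sub_self]
  · apply h0; rw [sub_self]

end Valuations

/-! ## §3  ONE CLASS: a nearly rank-one, nearly skew Gram operator has the thickened value set of ONE ray `a ↦ e₀·N(a)` -/

section OneClass

variable {K : Type} [Field K] [Valued K ℤᵐ⁰]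

/-- **ONE CLASS FROM THE PIVOT MINORS AND THE SKEW RELATION.**  `σ` an isometric involution, `|ϖ| = exp(−1)`, `Q ∈ M₃(K)` with: every entry `|Q_ij| ≤ |ϖ|^ℓ`, SOME entry
`|Q_pq| = |ϖ|^ℓ`, every pivot minor `|Q_pp Q_ij − Q_ip Q_pj| ≤ |ϖ|^{ℓ+P}`, skewness `|Q_ij + σQ_ji| ≤ |ϖ|^{ℓ+P}`, and `ℓ < P`.  THEN there is `e₀` with `|e₀| = |ϖ|^ℓ`,
`|e₀ + σe₀| ≤ |ϖ|^{ℓ+P}`, and for every `m ≤ P` the `ϖ^m`-thickened value set of `c ↦ (σc)ᵀQc` on integral vectors is the thickened RAY `{e₀·N(a) : |a| ≤ 1}`: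
(i) skewness and the principal minor at an extremal entry put an entry of exact level `ℓ` on the DIAGONAL, `Q_pp`; (ii) with `λ(y) = Σᵢ σ(yᵢ)Q_ip`, `r(y) = Σⱼ Q_pj yⱼ∕Q_pp`
the pivot minors give `(σy)ᵀQy ≡ λ(y)·r(y)` and skewness at `(y, e_p)` gives `r(y) ≡ −σλ(y)∕Q_pp` (mod `ϖ^P`); so `(σy)ᵀQy ≡ e₀·N(λ(y)∕Q_pp)`, `e₀ = −σQ_pp`, and
`y = σa·e_p` realises `a`. [cite: Rogawski1990, §4.9 Prop. 4.9.1 (b) p. 55] [cite: Jacobowitz1962, §4] -/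
theorem exists_rayScalar_setOf_eq_of_pivotMinors {σ : K →+* K} (hσσ : ∀ a, σ (σ a) = a) (hvσ : ∀ a, Valued.v (σ a) = Valued.v a)
    {ϖ : K} (hϖ : Valued.v ϖ = exp (-1 : ℤ)) {Q : Matrix (Fin 3) (Fin 3) K} {ℓ P : ℕ} (hℓP : ℓ < P)
    (h0 : ∀ i j, Valued.v (Q i j) ≤ Valued.v ϖ ^ ℓ) (h1 : ∃ p q, Valued.v (Q p q) = Valued.v ϖ ^ ℓ)
    (h2 : ∀ p i j, Valued.v (Q p p * Q i j - Q i p * Q p j) ≤ Valued.v ϖ ^ (ℓ + P))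
    (h3 : ∀ i j, Valued.v (Q i j + σ (Q j i)) ≤ Valued.v ϖ ^ (ℓ + P)) :
    ∃ e₀ : K, Valued.v e₀ = Valued.v ϖ ^ ℓ ∧ Valued.v (e₀ + σ e₀) ≤ Valued.v ϖ ^ (ℓ + P) ∧
      ∀ m : ℕ, m ≤ P →
        {z : K | ∃ y : Fin 3 → K, (∀ i, Valued.v (y i) ≤ 1) ∧
            Valued.v ((ϖ ^ m)⁻¹ * (z - ∑ i, ∑ j, σ (y i) * Q i j * y j)) ≤ 1} =
          {z : K | ∃ a : K, Valued.v a ≤ 1 ∧ Valued.v ((ϖ ^ m)⁻¹ * (z - e₀ * (a * σ a))) ≤ 1} := by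
  have hvϖ0 : Valued.v ϖ ≠ 0 := by rw [hϖ]; exact exp_ne_zero
  have hϖ1 : Valued.v ϖ ≤ 1 := by rw [hϖ, ← exp_zero, exp_le_exp]; norm_num
  have hϖlt : Valued.v ϖ < 1 := by rw [hϖ, ← exp_zero, exp_lt_exp]; norm_num
  have hpowpos : ∀ k : ℕ, (0 : ℤᵐ⁰) < Valued.v ϖ ^ k := fun k => pow_pos (zero_lt_iff.2 hvϖ0) k
  have hpow_lt : ∀ {a b : ℕ}, a < b → Valued.v ϖ ^ b < Valued.v ϖ ^ a := fun {a b} hab =>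
    pow_lt_pow_right_of_lt_one₀ (zero_lt_iff.2 hvϖ0) hϖlt hab
  -- (i) an entry of exact level `ℓ` on the diagonal
  obtain ⟨p, hp⟩ : ∃ p, Valued.v (Q p p) = Valued.v ϖ ^ ℓ := by
    obtain ⟨p, q, hpq⟩ := h1
    by_cases hp : Valued.v (Q p p) = Valued.v ϖ ^ ℓ
    · exact ⟨p, hp⟩
    by_cases hq : Valued.v (Q q q) = Valued.v ϖ ^ ℓ
    · exact ⟨q, hq⟩
    exfalso
    -- `|Q_qp| = |ϖ|^ℓ` by skewness
    have hqp : Valued.v (Q q p) = Valued.v ϖ ^ ℓ := by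
      have e : Q q p = -σ (Q p q) + (Q q p + σ (Q p q)) := by ring
      have hlt : Valued.v (Q q p + σ (Q p q)) < Valued.v (-σ (Q p q)) := by
        rw [Valuation.map_neg, hvσ, hpq]; exact (h3 q p).trans_lt (hpow_lt (by omega))
      rw [e, Valuation.map_add_eq_of_lt_left _ hlt, Valuation.map_neg, hvσ, hpq]
    -- the principal minor forces a contradiction: `|Q_pp Q_qq| < |Q_qp Q_pq| = |ϖ|^{2ℓ}` but their difference is deep
    have hpp' : Valued.v (Q p p) ≤ Valued.v ϖ ^ (ℓ + 1) := v_le_pow_succ_of_v_lt_pow hϖ (lt_of_le_of_ne (h0 p p) hp)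
    have hlt1 : Valued.v (Q p p * Q q q) < Valued.v ϖ ^ (ℓ + ℓ) := by
      rw [map_mul]
      calc Valued.v (Q p p) * Valued.v (Q q q) ≤ Valued.v ϖ ^ (ℓ + 1) * Valued.v ϖ ^ ℓ := mul_le_mul' hpp' (h0 q q)
        _ = Valued.v ϖ ^ (ℓ + ℓ + 1) := by rw [← pow_add]; congr 1; omega
        _ < Valued.v ϖ ^ (ℓ + ℓ) := hpow_lt (by omega)
    have hlt2 : Valued.v (Q p p * Q q q - Q q p * Q p q) < Valued.v ϖ ^ (ℓ + ℓ) := (h2 p q q).trans_lt (hpow_lt (by omega))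
    have e : Q q p * Q p q = Q p p * Q q q - (Q p p * Q q q - Q q p * Q p q) := by ring
    have hle := Valuation.map_sub Valued.v (Q p p * Q q q) (Q p p * Q q q - Q q p * Q p q)
    rw [← e, map_mul, hqp, hpq, ← pow_add] at hle
    exact absurd hle (not_le.2 (max_lt hlt1 hlt2))
  -- (ii) the pivot `Q_pp`
  have hQpp0 : Q p p ≠ 0 := fun h0' => by rw [h0', map_zero] at hp; exact (pow_ne_zero _ hvϖ0) hp.symm
  set e₀ : K := -σ (Q p p) with he₀_def
  have he₀ : Valued.v e₀ = Valued.v ϖ ^ ℓ := by rw [he₀_def, Valuation.map_neg, hvσ, hp]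
  have he₀tr : Valued.v (e₀ + σ e₀) ≤ Valued.v ϖ ^ (ℓ + P) := by
    have e : e₀ + σ e₀ = -(Q p p + σ (Q p p)) := by rw [he₀_def, map_neg, hσσ]; ring
    rw [e, Valuation.map_neg]; exact h3 p p
  refine ⟨e₀, he₀, he₀tr, fun m hm => ?_⟩
  -- (iii) the main estimate for an integral `y`: `(σy)ᵀQy ≡ e₀·N(λ(y)∕Q_pp) (mod ϖ^P)`, `λ(y) = Σ σ(yᵢ)Q_ip`
  have main : ∀ y : Fin 3 → K, (∀ i, Valued.v (y i) ≤ 1) →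
      Valued.v ((∑ i, σ (y i) * Q i p) / Q p p) ≤ 1 ∧
      Valued.v ((∑ i, ∑ j, σ (y i) * Q i j * y j) -
        e₀ * ((∑ i, σ (y i) * Q i p) / Q p p * σ ((∑ i, σ (y i) * Q i p) / Q p p))) ≤ Valued.v ϖ ^ P := by
    intro y hy
    set lam : K := ∑ i, σ (y i) * Q i p with hlam
    set ρ : K := ∑ j, Q p j * y j with hρ
    set S : K := ∑ i, ∑ j, σ (y i) * Q i j * y j with hS
    have hσy : ∀ i, Valued.v (σ (y i)) ≤ 1 := fun i => by rw [hvσ]; exact hy i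
    have hlam1 : Valued.v lam ≤ Valued.v ϖ ^ ℓ :=
      Valuation.map_sum_le _ fun i _ => by
        rw [map_mul]; exact (mul_le_mul' (hσy i) (h0 i p)).trans_eq (one_mul _)
    have ha1 : Valued.v (lam / Q p p) ≤ 1 := by
      rw [map_div₀, hp]; exact div_le_one_of_le₀ hlam1 (zero_le)
    -- (B1) `Q_pp·S ≡ λ·ρ` by the pivot minors
    have hB1 : Valued.v (Q p p * S - lam * ρ) ≤ Valued.v ϖ ^ (ℓ + P) := by
      have e : Q p p * S - lam * ρ = ∑ i, ∑ j, σ (y i) * y j * (Q p p * Q i j - Q i p * Q p j) := by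
        rw [hS, hlam, hρ, Finset.sum_mul_sum, Finset.mul_sum, ← Finset.sum_sub_distrib]
        refine Finset.sum_congr rfl fun i _ => ?_
        rw [Finset.mul_sum, ← Finset.sum_sub_distrib]
        exact Finset.sum_congr rfl fun j _ => by ring
      rw [e]
      refine Valuation.map_sum_le _ fun i _ => Valuation.map_sum_le _ fun j _ => ?_
      rw [map_mul, map_mul]
      calc Valued.v (σ (y i)) * Valued.v (y j) * Valued.v (Q p p * Q i j - Q i p * Q p j)
          ≤ 1 * 1 * Valued.v ϖ ^ (ℓ + P) := mul_le_mul' (mul_le_mul' (hσy i) (hy j)) (h2 p i j)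
        _ = Valued.v ϖ ^ (ℓ + P) := by rw [one_mul, one_mul]
    -- (B2) skewness at `(y, e_p)`: `σλ + ρ ≡ 0`
    have hB2 : Valued.v (σ lam + ρ) ≤ Valued.v ϖ ^ (ℓ + P) := by
      have e2 : σ lam + ρ = σ (∑ j, σ (y j) * (Q j p + σ (Q p j))) := by
        simp only [hlam, hρ, map_sum, map_mul, map_add, hσσ]
        rw [← Finset.sum_add_distrib]
        exact Finset.sum_congr rfl fun j _ => by ring
      rw [e2, hvσ]
      exact Valuation.map_sum_le _ fun j _ => by
        rw [map_mul]; exact (mul_le_mul' (hσy j) (h3 j p)).trans_eq (one_mul _)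
    -- (B3) combine: `S − e₀·N(λ∕Q_pp) = ((Q_pp S − λρ) + λ(σλ + ρ))∕Q_pp`
    refine ⟨ha1, ?_⟩
    have hσQ0 : σ (Q p p) ≠ 0 := (map_ne_zero σ).2 hQpp0
    have e3 : S - e₀ * (lam / Q p p * σ (lam / Q p p)) = ((Q p p * S - lam * ρ) + lam * (σ lam + ρ)) / Q p p := by
      rw [he₀_def, map_div₀]
      field_simp
      ring
    rw [e3, map_div₀, hp, div_le_iff₀ (hpowpos ℓ), ← pow_add, add_comm P ℓ]
    refine (Valuation.map_add _ _ _).trans (max_le hB1 ?_)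
    rw [map_mul]
    calc Valued.v lam * Valued.v (σ lam + ρ) ≤ Valued.v ϖ ^ ℓ * Valued.v ϖ ^ (ℓ + P) := mul_le_mul' hlam1 hB2
      _ ≤ 1 * Valued.v ϖ ^ (ℓ + P) := mul_le_mul' (pow_le_one₀ (zero_le) hϖ1) le_rfl
      _ = Valued.v ϖ ^ (ℓ + P) := one_mul _
  -- (iv) thickening bookkeeping
  have hmP : Valued.v ϖ ^ P ≤ Valued.v ϖ ^ m := pow_le_pow_right_of_le_one' hϖ1 hm
  have hpm0 : Valued.v (ϖ ^ m) ≠ 0 := by rw [map_pow]; exact pow_ne_zero _ hvϖ0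
  have absorb : ∀ z S T : K, Valued.v (S - T) ≤ Valued.v ϖ ^ P →
      Valued.v ((ϖ ^ m)⁻¹ * (z - S)) ≤ 1 → Valued.v ((ϖ ^ m)⁻¹ * (z - T)) ≤ 1 := by
    intro z S T hST hz
    have e : (ϖ ^ m)⁻¹ * (z - T) = (ϖ ^ m)⁻¹ * (z - S) + (ϖ ^ m)⁻¹ * (S - T) := by ring
    rw [e]
    refine (Valuation.map_add _ _ _).trans (max_le hz ?_)
    rw [map_mul, map_inv₀, inv_mul_le_iff₀ (zero_lt_iff.2 hpm0), mul_one, map_pow]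
    exact hST.trans hmP
  ext z
  simp only [Set.mem_setOf_eq]
  constructor
  · rintro ⟨y, hy, hz⟩
    obtain ⟨ha1, hclose⟩ := main y hy
    exact ⟨_, ha1, absorb z _ _ hclose hz⟩
  · rintro ⟨a, ha, hz⟩
    -- the vector `σa · e_p` realises `a`
    set y₀ : Fin 3 → K := Pi.single p (σ a) with hy₀
    have hy₀int : ∀ i, Valued.v (y₀ i) ≤ 1 := fun i => by
      by_cases hi : i = p
      · subst hi; rw [hy₀, Pi.single_eq_same, hvσ]; exact ha
      · rw [hy₀, Pi.single_eq_of_ne hi, map_zero]; exact zero_le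
    refine ⟨y₀, hy₀int, ?_⟩
    obtain ⟨-, hclose⟩ := main y₀ hy₀int
    have hlam : (∑ i, σ (y₀ i) * Q i p) / Q p p = a := by
      rw [Finset.sum_eq_single p (fun i _ hi => by rw [hy₀, Pi.single_eq_of_ne hi, map_zero, zero_mul])
        (fun h => absurd (Finset.mem_univ p) h), hy₀, Pi.single_eq_same, hσσ, mul_div_assoc, div_self hQpp0, mul_one]
    rw [hlam, Valuation.map_sub_swap] at hclose
    exact absorb z _ _ hclose hz

end OneClass

end Summit.HodgeConjecture.HodgeConjecture.Cruxes.H413.F0P3cDyRamRankOneSkewValueSet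

end
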